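import Literature.NumberTheory.EllipticCurves.RealLatticePeriodHalfPeriodsProofs
import Mathlib.Analysis.Calculus.InverseFunctionTheorem.Deriv
import Mathlib.Analysis.Calculus.Deriv.Inverse
import Mathlib.Analysis.Calculus.ContDiff.RCLike
import Mathlib.Analysis.Complex.OpenMapping
import Mathlib.Analysis.Real.Cardinality
import Mathlib.MeasureTheory.Integral.IntervalIntegral.FundThmCalculus
import Mathlib.RingTheory.Algebraic.Integral
import HarnessLib

/-!
# Lattice vectors as sums of elliptic integrals along algebraic segments

Auxiliary file for the discharge of
`Literature.NumberTheory.Transcendental.isPeriod_of_mem_lattice` (Kontsevich–Zagier 2001, §1.1: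
the periods of the elliptic curve `y² = 4x³ − g₂x − g₃` over `ℚ̄` are periods). For a period
pair `L` (Mathlib `PeriodPair`, `℘ = ℘[L]`, `℘' = ℘'[L]`, lattice `Λ`) and `l ∈ Λ`, `l ≠ 0`, we
prove (`Literature.NumberTheory.Transcendental.exists_elliptic_chain`) that

  `l = ∑_{i<N} ∫₀¹ vᵢ ds / yᵢ(s)`,

where `xᵢ, vᵢ ∈ ℚ(i)` (so their real and imaginary parts are algebraic), and
`yᵢ : [0, 1] → ℂˣ` is a continuous function with `yᵢ(s)² = 4(xᵢ + s vᵢ)³ − g₂(xᵢ + s vᵢ) − g₃`: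
each summand is the integral of the invariant differential `dx/y` of `y² = 4x³ − g₂x − g₃` along
the straight segment from `xᵢ` to `xᵢ₊₁ = xᵢ + vᵢ` in the `x`-plane, for a continuous branch of
`y`.

The proof is the classical remark that `z ↦ (℘(z), ℘'(z))` pulls `dx/y` back to `dz`
(Silverman, AEC VI.3.6 with VI §1; Whittaker–Watson §20.22, `z = ∫ dx/√(4x³ − g₂x − g₃)`),
organised so that no covering-space theory is needed:

1. off `½Λ` the map `℘` is a local biholomorphism (`℘' ≠ 0` there:
   `PeriodPair.two_mul_mem_lattice_of_derivWeierstrassP_eq_zero`; inverse function theorem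
   `HasStrictFDerivAt.toOpenPartialHomeomorph`), with local inverse `ψ` satisfying
   `ψ' = 1/℘'(ψ)` (`OpenPartialHomeomorph.hasDerivAt_symm`) — `exists_localInverse`;
2. a segment `[c, c + l]` avoiding `½Λ` exists (the bad offsets are countable) —
   `exists_segment_notMem`; cover it by finitely many such charts (Lebesgue number) and choose
   mesh points `z₀, …, z_N = z₀ + l`, consecutive ones in a common chart, with `℘(zᵢ) ∈ ℚ(i)`
   (open mapping theorem `AnalyticAt.eventually_constant_or_nhds_le_map_nhds` and periodicity
   of `℘`) — `exists_near_weierstrassP_rat`;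
3. in a chart, `zᵢ₊₁ − zᵢ = ψ(xᵢ₊₁) − ψ(xᵢ) = ∫₀¹ vᵢ/℘'(ψ(xᵢ + s vᵢ)) ds` by the chain rule and
   the fundamental theorem of calculus, and `y = ℘' ∘ ψ` satisfies `y² = 4x³ − g₂x − g₃`
   (`PeriodPair.derivWeierstrassP_sq`); summing telescopes to `l`.

No new definitions are introduced.

## References

* M. Kontsevich, D. Zagier, *Periods*, in: Mathematics Unlimited — 2001 and Beyond, Springer
  (2001), §1.1.
* J. H. Silverman, *The Arithmetic of Elliptic Curves*, 2nd ed. (2009), VI.3.6, VI §1.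
* E. T. Whittaker, G. N. Watson, *A Course of Modern Analysis*, §20.22.
-/

noncomputable section

open scoped Topology PeriodPair
open Filter Set Metric Complex

namespace Literature.NumberTheory.Transcendental

/-! ### The complement of the half-lattice -/

/-- `ℂ ∖ ½Λ = {w | w ∉ Λ, 2w ∉ Λ}` is open. [folklore] -/
theorem isOpen_setOf_notMem_half_lattice (L : PeriodPair) :
    IsOpen {w : ℂ | w ∉ L.lattice ∧ 2 * w ∉ L.lattice} := by
  have h1 : IsClosed (L.lattice : Set ℂ) := L.isClosed_lattice
  have h2 : IsClosed ((fun w : ℂ => 2 * w) ⁻¹' (L.lattice : Set ℂ)) :=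
    h1.preimage (continuous_const.mul continuous_id)
  have : {w : ℂ | w ∉ L.lattice ∧ 2 * w ∉ L.lattice} =
      ((L.lattice : Set ℂ) ∪ (fun w : ℂ => 2 * w) ⁻¹' (L.lattice : Set ℂ))ᶜ := by
    ext w
    simp
  rw [this]
  exact (h1.union h2).isOpen_compl

/-- For `l ≠ 0` there is a whole line `c + ℝ l` avoiding `½Λ`: the offsets `s` for which the line
`s·il + ℝ l` meets the countable set `Λ ∪ ½Λ` form a countable subset of `ℝ`. [folklore] -/
theorem exists_segment_notMem (L : PeriodPair) {l : ℂ} (hl0 : l ≠ 0) :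
    ∃ c : ℂ, ∀ t : ℝ, c + t * l ∉ L.lattice ∧ 2 * (c + t * l) ∉ L.lattice := by
  have hSc : ((L.lattice : Set ℂ) ∪ (fun w : ℂ => 2 * w) ⁻¹' (L.lattice : Set ℂ)).Countable :=
    L.countable_lattice.union (L.countable_lattice.preimage (mul_right_injective₀ two_ne_zero))
  have hBc : ((fun w : ℂ => (w / l).im) ''
      ((L.lattice : Set ℂ) ∪ (fun w : ℂ => 2 * w) ⁻¹' (L.lattice : Set ℂ))).Countable :=
    hSc.image _
  obtain ⟨s, hs⟩ : ∃ s : ℝ, s ∉ (fun w : ℂ => (w / l).im) ''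
      ((L.lattice : Set ℂ) ∪ (fun w : ℂ => 2 * w) ⁻¹' (L.lattice : Set ℂ)) := by
    by_contra! h
    exact Cardinal.not_countable_real (hBc.mono fun s _ => h s)
  refine ⟨(s : ℂ) * (I * l), fun t => ?_⟩
  have key : ∀ w ∈ (L.lattice : Set ℂ) ∪ (fun w : ℂ => 2 * w) ⁻¹' (L.lattice : Set ℂ),
      w ≠ (s : ℂ) * (I * l) + t * l := by
    rintro w hw rfl
    apply hs
    refine ⟨_, hw, ?_⟩
    have : ((s : ℂ) * (I * l) + (t : ℂ) * l) / l = (t : ℂ) + (s : ℂ) * I := by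
      field_simp
      ring
    simp only [this, add_im, ofReal_im, mul_im, ofReal_re, I_im, I_re, mul_zero, mul_one,
      zero_add, add_zero]
  exact ⟨fun h => key _ (Or.inl h) rfl, fun h => key _ (Or.inr h) rfl⟩

/-! ### Local inverses of `℘` off the half-lattice -/

/-- **`℘` is a local biholomorphism off `½Λ`.** For `z ∉ ½Λ` there are an open `W ∋ z`, a radius
`r > 0` and a map `ψ` with: `℘(W) ⊆ B(℘ z, r)` and `ψ ∘ ℘ = id` on `W`; `ψ` is continuous on
`B(℘ z, r)`, takes values off `Λ` with `℘ ∘ ψ = id`, `℘'(ψ x) ≠ 0` and `ψ'(x) = 1/℘'(ψ x)` there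
(inverse function theorem; `℘' ≠ 0` off `½Λ`). [Silverman AEC VI.3.6; Whittaker–Watson §20.22]
[folklore] -/
theorem exists_localInverse (L : PeriodPair) {z : ℂ} (hz : z ∉ L.lattice)
    (hz2 : 2 * z ∉ L.lattice) :
    ∃ (W : Set ℂ) (ψ : ℂ → ℂ) (r : ℝ), IsOpen W ∧ z ∈ W ∧ 0 < r ∧
      (∀ a ∈ W, ℘[L] a ∈ ball (℘[L] z) r ∧ ψ (℘[L] a) = a) ∧
      ContinuousOn ψ (ball (℘[L] z) r) ∧
      (∀ x ∈ ball (℘[L] z) r, ψ x ∉ L.lattice ∧ ℘[L] (ψ x) = x ∧ ℘'[L] (ψ x) ≠ 0 ∧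
        HasDerivAt ψ (℘'[L] (ψ x))⁻¹ x) := by
  have hderiv : ∀ w : ℂ, w ∉ L.lattice → HasDerivAt ℘[L] (℘'[L] w) w := fun w hw => by
    have hd : DifferentiableAt ℂ ℘[L] w :=
      L.differentiableOn_weierstrassP.differentiableAt
        (L.isClosed_lattice.isOpen_compl.mem_nhds hw)
    simpa using hd.hasDerivAt
  have hne : ∀ w : ℂ, w ∉ L.lattice → 2 * w ∉ L.lattice → ℘'[L] w ≠ 0 := fun w hw hw2 h =>
    hw2 (L.two_mul_mem_lattice_of_derivWeierstrassP_eq_zero hw h)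
  have hstrict : HasStrictDerivAt ℘[L] (℘'[L] z) z := by
    have han : AnalyticAt ℂ ℘[L] z := L.analyticOnNhd_weierstrassP z hz
    have h := (han.contDiffAt (n := 1)).hasStrictDerivAt one_ne_zero
    simpa using h
  have h0 : ℘'[L] z ≠ 0 := hne z hz hz2
  set e := (hstrict.hasStrictFDerivAt_equiv h0).toOpenPartialHomeomorph ℘[L] with he
  have hz_src : z ∈ e.source :=
    (hstrict.hasStrictFDerivAt_equiv h0).mem_toOpenPartialHomeomorph_source
  have hG : IsOpen {w : ℂ | w ∉ L.lattice ∧ 2 * w ∉ L.lattice} :=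
    isOpen_setOf_notMem_half_lattice L
  have hT'open : IsOpen (e.target ∩
      e.symm ⁻¹' (e.source ∩ {w : ℂ | w ∉ L.lattice ∧ 2 * w ∉ L.lattice})) :=
    e.symm.isOpen_inter_preimage (e.open_source.inter hG)
  have hzT' : ℘[L] z ∈ e.target ∩
      e.symm ⁻¹' (e.source ∩ {w : ℂ | w ∉ L.lattice ∧ 2 * w ∉ L.lattice}) := by
    refine ⟨e.map_source hz_src, ?_⟩
    show e.symm (e z) ∈ e.source ∩ {w : ℂ | w ∉ L.lattice ∧ 2 * w ∉ L.lattice}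
    rw [e.left_inv hz_src]
    exact ⟨hz_src, hz, hz2⟩
  obtain ⟨r, hr, hball⟩ := Metric.isOpen_iff.mp hT'open _ hzT'
  refine ⟨e.source ∩ ℘[L] ⁻¹' ball (℘[L] z) r, e.symm, r, e.isOpen_inter_preimage isOpen_ball,
    ⟨hz_src, mem_ball_self hr⟩, hr, ?_, ?_, ?_⟩
  · rintro a ⟨ha_src, ha_ball⟩
    exact ⟨ha_ball, e.left_inv ha_src⟩
  · exact e.continuousOn_symm.mono fun x hx => (hball hx).1
  · intro x hx
    obtain ⟨hx_tgt, -, hxΛ, hx2⟩ := hball hx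
    exact ⟨hxΛ, e.right_inv hx_tgt, hne _ hxΛ hx2,
      e.hasDerivAt_symm hx_tgt (hne _ hxΛ hx2) (hderiv _ hxΛ)⟩

/-- **Open mapping.** Near any `c ∉ ½Λ` there are points `z` with `℘(z) ∈ ℚ(i)`: `℘` is analytic
and not locally constant at `c` (`℘'(c) ≠ 0`), so `℘` maps neighbourhoods of `c` onto
neighbourhoods of `℘(c)`, which contain points with rational real and imaginary parts. [folklore] -/
theorem exists_near_weierstrassP_rat (L : PeriodPair) {c : ℂ} (hc : c ∉ L.lattice)
    (hc2 : 2 * c ∉ L.lattice) {ρ : ℝ} (hρ : 0 < ρ) :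
    ∃ z : ℂ, dist z c < ρ ∧ (∃ q : ℚ, (℘[L] z).re = q) ∧ (∃ q : ℚ, (℘[L] z).im = q) := by
  have han : AnalyticAt ℂ ℘[L] c := L.analyticOnNhd_weierstrassP c hc
  have hne : ℘'[L] c ≠ 0 := fun h =>
    hc2 (L.two_mul_mem_lattice_of_derivWeierstrassP_eq_zero hc h)
  rcases han.eventually_constant_or_nhds_le_map_nhds with h | h
  · exfalso
    apply hne
    have h1 : deriv ℘[L] c = deriv (fun _ : ℂ => ℘[L] c) c := Filter.EventuallyEq.deriv_eq h
    simpa using h1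
  · have hmem : ℘[L] '' ball c ρ ∈ 𝓝 (℘[L] c) := h (image_mem_map (ball_mem_nhds c hρ))
    obtain ⟨ε, hε, hsub⟩ := Metric.mem_nhds_iff.mp hmem
    obtain ⟨q₁, hq₁, hq₁'⟩ :=
      exists_rat_btwn (show (℘[L] c).re - ε / 2 < (℘[L] c).re + ε / 2 by linarith)
    obtain ⟨q₂, hq₂, hq₂'⟩ :=
      exists_rat_btwn (show (℘[L] c).im - ε / 2 < (℘[L] c).im + ε / 2 by linarith)
    have hx : (⟨q₁, q₂⟩ : ℂ) ∈ ball (℘[L] c) ε := by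
      rw [mem_ball, dist_eq_norm]
      calc ‖(⟨q₁, q₂⟩ : ℂ) - ℘[L] c‖
          ≤ |((⟨q₁, q₂⟩ : ℂ) - ℘[L] c).re| + |((⟨q₁, q₂⟩ : ℂ) - ℘[L] c).im| :=
            norm_le_abs_re_add_abs_im _
        _ < ε / 2 + ε / 2 := by
            gcongr
            · rw [sub_re, abs_sub_lt_iff]
              exact ⟨by simp only; linarith, by simp only; linarith⟩
            · rw [sub_im, abs_sub_lt_iff]
              exact ⟨by simp only; linarith, by simp only; linarith⟩
        _ = ε := by ring
    obtain ⟨z, hz, hzx⟩ := hsub hx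
    exact ⟨z, mem_ball.mp hz, ⟨q₁, by rw [hzx]⟩, ⟨q₂, by rw [hzx]⟩⟩

/-! ### The chain -/

/-- A rational real number is algebraic over `ℚ`. [folklore] -/
theorem isAlgebraic_of_exists_rat {x : ℝ} (hx : ∃ q : ℚ, x = q) : IsAlgebraic ℚ x := by
  obtain ⟨q, rfl⟩ := hx
  exact ⟨Polynomial.X - Polynomial.C q, Polynomial.X_sub_C_ne_zero q, by simp⟩

/-- **Lattice vectors as sums of elliptic integrals along algebraic segments.** Let `L` be a
period pair with lattice `Λ` and let `0 ≠ l ∈ Λ`. Then there are `N`, points `xᵢ` and vectors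
`vᵢ` (`i < N`) with algebraic real and imaginary parts (indeed in `ℚ(i)`), and continuous
functions `yᵢ : [0, 1] → ℂ` with `yᵢ(s) ≠ 0` and `yᵢ(s)² = 4(xᵢ + s vᵢ)³ − g₂ (xᵢ + s vᵢ) − g₃`,
such that `l = ∑_{i<N} ∫₀¹ vᵢ / yᵢ(s) ds` — each term being `∫ dx/y` over the segment
`[xᵢ, xᵢ + vᵢ]` on `y² = 4x³ − g₂x − g₃` for a continuous branch of `y`. This is the statement
"`dz = dx/y` under `x = ℘(z)`, `y = ℘'(z)`" (Silverman AEC VI.3.6; Whittaker–Watson §20.22)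
integrated along a chain of local inverses of `℘` joining `z₀` to `z₀ + l`.
[Kontsevich–Zagier 2001, §1.1 (elliptic integrals as periods)] [cite: KontsevichZagier2001, §1.1] -/
theorem exists_elliptic_chain (L : PeriodPair) {l : ℂ} (hl : l ∈ L.lattice) (hl0 : l ≠ 0) :
    ∃ (N : ℕ) (x v : ℕ → ℂ) (y : ℕ → ℝ → ℂ),
      (∀ i < N, IsAlgebraic ℚ (x i).re ∧ IsAlgebraic ℚ (x i).im ∧
        IsAlgebraic ℚ (v i).re ∧ IsAlgebraic ℚ (v i).im) ∧
      (∀ i < N, ContinuousOn (y i) (Icc 0 1)) ∧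
      (∀ i < N, ∀ s ∈ Icc (0 : ℝ) 1, y i s ≠ 0 ∧
        y i s ^ 2 = 4 * (x i + s * v i) ^ 3 - L.g₂ * (x i + s * v i) - L.g₃) ∧
      l = ∑ i ∈ Finset.range N, ∫ s in (0 : ℝ)..1, v i / y i s := by
  classical
  -- the good set `G = ℂ ∖ ½Λ` and a segment `[c, c + l] ⊆ G`
  obtain ⟨c, hc⟩ := exists_segment_notMem L hl0
  haveI : Nonempty {w : ℂ // w ∉ L.lattice ∧ 2 * w ∉ L.lattice} :=
    ⟨⟨c + (0 : ℝ) * l, hc 0⟩⟩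
  -- local inverses, indexed by the points of `G`
  have hloc := fun p : {w : ℂ // w ∉ L.lattice ∧ 2 * w ∉ L.lattice} =>
    exists_localInverse L p.2.1 p.2.2
  choose W ψ r hWopen hzW hr hWψ hψcont hψ using hloc
  -- the compact segment and a Lebesgue number of its cover by the `W`'s
  set γ : ℝ → ℂ := fun t => c + t * l with hγ
  have hγcont : Continuous γ := by
    simp only [hγ]
    fun_prop
  have hK : IsCompact (γ '' Icc 0 1) := isCompact_Icc.image hγcont
  have hcover : γ '' Icc 0 1 ⊆ ⋃ p : {w : ℂ // w ∉ L.lattice ∧ 2 * w ∉ L.lattice}, W p := by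
    rintro _ ⟨t, -, rfl⟩
    exact mem_iUnion.2 ⟨⟨γ t, hc t⟩, hzW _⟩
  obtain ⟨δ, hδ, hleb⟩ := lebesgue_number_lemma_of_metric hK (fun p => hWopen p) hcover
  -- the mesh `N`
  obtain ⟨N, hN⟩ : ∃ N : ℕ, 3 * ‖l‖ / δ < N := exists_nat_gt _
  have hNpos : 0 < N := by
    have : (0 : ℝ) < N := lt_of_le_of_lt (by positivity) hN
    exact_mod_cast this
  have hNreal : (0 : ℝ) < N := by exact_mod_cast hNpos
  have hN0 : (N : ℝ) ≠ 0 := hNreal.ne'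
  have hN' : ‖l‖ / N < δ / 3 := by
    have h1 : 3 * ‖l‖ < N * δ := (div_lt_iff₀ hδ).mp hN
    rw [div_lt_div_iff₀ hNreal (by norm_num : (0 : ℝ) < 3)]
    linarith
  -- base points `cₖ = c + (k/N) l`
  set cpt : ℕ → ℂ := fun k => γ ((k : ℝ) / N) with hcpt
  have hcptG : ∀ k, cpt k ∉ L.lattice ∧ 2 * cpt k ∉ L.lattice := fun k => hc _
  have hcptK : ∀ k ≤ N, cpt k ∈ γ '' Icc 0 1 := fun k hk =>
    ⟨(k : ℝ) / N, ⟨by positivity, div_le_one_of_le₀ (by exact_mod_cast hk) hNreal.le⟩, rfl⟩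
  have hdist_cpt : ∀ k : ℕ, dist (cpt (k + 1)) (cpt k) = ‖l‖ / N := by
    intro k
    rw [dist_eq_norm]
    have : cpt (k + 1) - cpt k = ((N : ℂ))⁻¹ * l := by
      simp only [hcpt, hγ]
      push_cast
      field_simp
      ring
    rw [this, norm_mul, norm_inv, Complex.norm_natCast, div_eq_inv_mul]
  have hcptN : cpt N = cpt 0 + l := by
    have hN0c : (N : ℂ) ≠ 0 := by exact_mod_cast hNpos.ne'
    simp only [hcpt, hγ]
    push_cast
    simp [hN0c]
  -- perturbed mesh points with `℘`-values in `ℚ(i)`, the last one being the first one `+ l`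
  have hpert : ∀ k : ℕ, ∃ z : ℂ, dist z (cpt k) < δ / 3 ∧ (∃ q : ℚ, (℘[L] z).re = q) ∧
      (∃ q : ℚ, (℘[L] z).im = q) :=
    fun k => exists_near_weierstrassP_rat L (hcptG k).1 (hcptG k).2 (by positivity)
  choose zf hzf_dist hzf_re hzf_im using hpert
  set Z : ℕ → ℂ := fun k => if k = N then zf 0 + l else zf k with hZ
  have hZ0 : Z 0 = zf 0 := by simp [hZ, hNpos.ne]
  have hZN : Z N = zf 0 + l := by simp [hZ]
  have hZlt : ∀ k < N, Z k = zf k := fun k hk => by simp [hZ, hk.ne]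
  have hZdist : ∀ k ≤ N, dist (Z k) (cpt k) < δ / 3 := by
    intro k hk
    rcases hk.lt_or_eq with hk | rfl
    · rw [hZlt k hk]
      exact hzf_dist k
    · rw [hZN, hcptN, dist_add_right]
      exact hzf_dist 0
  have h℘Z : ∀ k ≤ N, (∃ q : ℚ, (℘[L] (Z k)).re = q) ∧ (∃ q : ℚ, (℘[L] (Z k)).im = q) := by
    intro k hk
    rcases hk.lt_or_eq with hk | rfl
    · rw [hZlt k hk]
      exact ⟨hzf_re k, hzf_im k⟩
    · rw [hZN, L.weierstrassP_add_coe (zf 0) ⟨l, hl⟩]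
      exact ⟨hzf_re 0, hzf_im 0⟩
  -- consecutive mesh points lie in a common chart
  have hchart : ∀ k < N, ∃ p : {w : ℂ // w ∉ L.lattice ∧ 2 * w ∉ L.lattice},
      Z k ∈ W p ∧ Z (k + 1) ∈ W p := by
    intro k hk
    obtain ⟨p, hp⟩ := hleb (cpt k) (hcptK k hk.le)
    refine ⟨p, hp ?_, hp ?_⟩
    · exact mem_ball.2 ((hZdist k hk.le).trans (by linarith))
    · rw [mem_ball]
      calc dist (Z (k + 1)) (cpt k)
          ≤ dist (Z (k + 1)) (cpt (k + 1)) + dist (cpt (k + 1)) (cpt k) := dist_triangle _ _ _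
        _ < δ / 3 + δ / 3 := add_lt_add (hZdist (k + 1) hk) (by rw [hdist_cpt]; exact hN')
        _ < δ := by linarith
  choose! P hP using hchart
  -- the data
  set x : ℕ → ℂ := fun k => ℘[L] (Z k) with hx
  set v : ℕ → ℂ := fun k => x (k + 1) - x k with hv
  set y : ℕ → ℝ → ℂ := fun k s => ℘'[L] (ψ (P k) (x k + s * v k)) with hy
  -- facts in the chart of `k < N`
  have hxB : ∀ k < N, x k ∈ ball (℘[L] (P k)) (r (P k)) ∧ ψ (P k) (x k) = Z k :=
    fun k hk => hWψ (P k) (Z k) (hP k hk).1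
  have hxB' : ∀ k < N, x (k + 1) ∈ ball (℘[L] (P k)) (r (P k)) ∧ ψ (P k) (x (k + 1)) = Z (k + 1) :=
    fun k hk => hWψ (P k) (Z (k + 1)) (hP k hk).2
  have hseg : ∀ k < N, ∀ s ∈ Icc (0 : ℝ) 1, x k + s * v k ∈ ball (℘[L] (P k)) (r (P k)) := by
    intro k hk s hs
    have h := (convex_ball (℘[L] (P k)) (r (P k))).add_smul_sub_mem (hxB k hk).1 (hxB' k hk).1 hs
    simpa [hv, Complex.real_smul] using h
  refine ⟨N, x, v, y, ?_, ?_, ?_, ?_⟩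
  · -- algebraicity of `xₖ, vₖ`
    intro k hk
    have h1 := h℘Z k hk.le
    have h2 := h℘Z (k + 1) hk
    have hre : IsAlgebraic ℚ (x k).re := isAlgebraic_of_exists_rat (by
      obtain ⟨q, hq⟩ := h1.1; exact ⟨q, hq⟩)
    have him : IsAlgebraic ℚ (x k).im := isAlgebraic_of_exists_rat (by
      obtain ⟨q, hq⟩ := h1.2; exact ⟨q, hq⟩)
    have hre' : IsAlgebraic ℚ (x (k + 1)).re := isAlgebraic_of_exists_rat (by
      obtain ⟨q, hq⟩ := h2.1; exact ⟨q, hq⟩)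
    have him' : IsAlgebraic ℚ (x (k + 1)).im := isAlgebraic_of_exists_rat (by
      obtain ⟨q, hq⟩ := h2.2; exact ⟨q, hq⟩)
    refine ⟨hre, him, ?_, ?_⟩
    · simpa [hv] using hre'.sub hre
    · simpa [hv] using him'.sub him
  · -- continuity of `yₖ` on `[0, 1]`
    intro k hk
    have h1 : ContinuousOn (fun s : ℝ => x k + s * v k) (Icc 0 1) := by fun_prop
    have h2 : ContinuousOn (ψ (P k)) (ball (℘[L] (P k)) (r (P k))) := hψcont (P k)
    have h3 : ContinuousOn ℘'[L] (L.lattice : Set ℂ)ᶜ :=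
      L.differentiableOn_derivWeierstrassP.continuousOn
    refine h3.comp (h2.comp h1 fun s hs => hseg k hk s hs) fun s hs => ?_
    exact (hψ (P k) _ (hseg k hk s hs)).1
  · -- `yₖ ≠ 0` and `yₖ² = 4x³ − g₂x − g₃` along the segment
    intro k hk s hs
    obtain ⟨hΛ, h℘, hne, -⟩ := hψ (P k) _ (hseg k hk s hs)
    refine ⟨hne, ?_⟩
    have := L.derivWeierstrassP_sq (ψ (P k) (x k + s * v k)) hΛ
    simpa only [hy, h℘] using this
  · -- `l = ∑ (Z (k+1) − Z k) = ∑ ∫₀¹ vₖ / yₖ`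
    have htel : l = ∑ k ∈ Finset.range N, (Z (k + 1) - Z k) := by
      rw [Finset.sum_range_sub, hZN, hZ0, add_sub_cancel_left]
    rw [htel]
    refine Finset.sum_congr rfl fun k hk => ?_
    rw [Finset.mem_range] at hk
    -- fundamental theorem of calculus for `s ↦ ψ (xₖ + s vₖ)`
    have hder : ∀ s ∈ uIcc (0 : ℝ) 1,
        HasDerivAt (fun s : ℝ => ψ (P k) (x k + s * v k)) (v k / y k s) s := by
      intro s hs
      rw [uIcc_of_le zero_le_one] at hs
      obtain ⟨-, -, hne, hd⟩ := hψ (P k) _ (hseg k hk s hs)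
      have hinner : HasDerivAt (fun s : ℝ => x k + s * v k) (1 * v k) s :=
        ((Complex.ofRealCLM.hasDerivAt).mul_const (v k)).const_add (x k)
      have hcomp := hd.comp s hinner
      refine hcomp.congr_deriv ?_
      simp only [hy, one_mul]
      rw [inv_mul_eq_div]
    have hint : IntervalIntegrable (fun s => v k / y k s) MeasureTheory.volume 0 1 := by
      refine ContinuousOn.intervalIntegrable ?_
      rw [uIcc_of_le zero_le_one]
      obtain ⟨-, hcont, hsq, -⟩ : True ∧ (∀ i < N, ContinuousOn (y i) (Icc 0 1)) ∧
          (∀ i < N, ∀ s ∈ Icc (0 : ℝ) 1, y i s ≠ 0) ∧ True := by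
        refine ⟨trivial, ?_, ?_, trivial⟩
        · intro i hi
          have h1 : ContinuousOn (fun s : ℝ => x i + s * v i) (Icc 0 1) := by fun_prop
          have h3 : ContinuousOn ℘'[L] (L.lattice : Set ℂ)ᶜ :=
            L.differentiableOn_derivWeierstrassP.continuousOn
          refine h3.comp ((hψcont (P i)).comp h1 fun s hs => hseg i hi s hs) fun s hs => ?_
          exact (hψ (P i) _ (hseg i hi s hs)).1
        · intro i hi s hs
          exact (hψ (P i) _ (hseg i hi s hs)).2.2.1
      exact continuousOn_const.div (hcont k hk) fun s hs => hsq k hk s hs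
    rw [intervalIntegral.integral_eq_sub_of_hasDerivAt hder hint]
    simp only [hv, Complex.ofReal_one, one_mul, Complex.ofReal_zero, zero_mul, add_zero,
      add_sub_cancel]
    rw [(hxB' k hk).2, (hxB k hk).2]

end Literature.NumberTheory.Transcendental
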